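import Summits.NavierStokesRegularity.FluidComputer.DihedralSector
import HarnessLib

/-!
# The dihedral sector: the mirror-line theorem is sharp at the next shell (`|k|² = 5`)

HONEST FRAMING (cell `pub-fluidc`, verbatim): *low prior, high value-of-information experiment on Tao's
machine paradigm; NOT a claim that NS blows up.* Nothing here concerns the Navier–Stokes PDE beyond the
Galerkin-truncated ODE system both engines of the cell integrate.

`DihedralSector.coeff_eq_zero_of_mirror_line` empties, for a Fourier velocity fixed by `G = T_a ∘ (x ↦ -x)`,
`S = T_a ∘ (z ↦ -z)` and the quarter turn `R90`, the `z`-mean modes on the four mirror lines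
`k₀ k₁ (k₀² − k₁²) = 0`, hence (with the vertical sublattice) every mode with `|k|² ≤ 4`. THIS FILE records the
printed witness that NOTHING MORE of the `z`-mean plane is forced to vanish (GADGETS gen 46, F46-1: the
`D₄`-pseudoscalar sector `A₂`, stream function `ψ = sin x sin y (cos x − cos y)`): the explicit real,
divergence-free field `wit = ∇⊥ψ`-type datum carried by the eight modes `(±2,±1,0)`, `(±1,±2,0)`,
`û(k) = i · k₀k₁(k₀²−k₁²) · (k₁, −k₀, 0)`, is fixed by `G`, `S` (every vertical shift), by `R90` and by every
vertical translation, and has `û(2,1,0) ≠ 0` (`mirror_line_sharp`). So the hypotheses of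
`coeff_eq_zero_of_mirror_line` / `mirror_lines_empty` / `low_modes_empty` do not empty the shell `|k|² = 5`
(at the initial time; nothing is claimed about later times of that datum's evolution). 0 sorry, 0 named facts
(D-0026). [folklore]
-/

noncomputable section

namespace Summit.NavierStokesRegularity.FluidComputer.DihedralSector

open Literature.Analysis.FluidPDE.FluidComputer
open Literature.Analysis.FluidPDE.FluidComputer.ShellTransfer
open Complex ComplexConjugate

/-- The witness coefficients as a function of the three components of `k`:
`i · k₀k₁(k₀²−k₁²) · (k₁, −k₀, 0)` on `k₂ = 0 ∧ k₀² + k₁² = 5`, zero elsewhere. [folklore] -/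
def wc (k₀ k₁ k₂ : ℤ) (j : Fin 3) : ℂ :=
  if k₂ = 0 ∧ k₀ ^ 2 + k₁ ^ 2 = 5 then
    I * ((k₀ * k₁ * (k₀ ^ 2 - k₁ ^ 2) : ℤ) : ℂ) * (((![k₁, -k₀, 0] : Fin 3 → ℤ) j : ℤ) : ℂ)
  else 0

/-- [folklore] -/
theorem wc_zero (k₀ k₁ k₂ : ℤ) : wc k₀ k₁ k₂ 0 =
    if k₂ = 0 ∧ k₀ ^ 2 + k₁ ^ 2 = 5 then I * ((k₀ * k₁ * (k₀ ^ 2 - k₁ ^ 2) : ℤ) : ℂ) * (k₁ : ℂ) else 0 := by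
  unfold wc; simp
/-- [folklore] -/
theorem wc_one (k₀ k₁ k₂ : ℤ) : wc k₀ k₁ k₂ 1 =
    if k₂ = 0 ∧ k₀ ^ 2 + k₁ ^ 2 = 5 then I * ((k₀ * k₁ * (k₀ ^ 2 - k₁ ^ 2) : ℤ) : ℂ) * (-(k₀ : ℂ)) else 0 := by
  unfold wc; simp
/-- [folklore] -/
theorem wc_two (k₀ k₁ k₂ : ℤ) : wc k₀ k₁ k₂ 2 = 0 := by
  unfold wc; simp

/-- Off the set `k₂ = 0 ∧ k₀² + k₁² = 5` the witness vanishes. [folklore] -/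
theorem wc_of_not {k₀ k₁ k₂ : ℤ} (h : ¬(k₂ = 0 ∧ k₀ ^ 2 + k₁ ^ 2 = 5)) (j : Fin 3) : wc k₀ k₁ k₂ j = 0 := by
  unfold wc; rw [if_neg h]

/-- **The witness field** `û(k) = i·k₀k₁(k₀²−k₁²)·(k₁,−k₀,0)` on the eight `z`-mean modes with `|k|² = 5`
(a multiple of `∇⊥ψ`, `ψ = sin x sin y (cos x − cos y)`): real and divergence-free. [folklore] -/
def wit : FourierVelocity where
  coeff k := wc (k 0) (k 1) (k 2)
  reality k i := by
    show wc ((-k) 0) ((-k) 1) ((-k) 2) i = conj (wc (k 0) (k 1) (k 2) i)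
    simp only [Pi.neg_apply]
    by_cases h : k 2 = 0 ∧ k 0 ^ 2 + k 1 ^ 2 = 5
    · have h' : -k 2 = 0 ∧ (-k 0) ^ 2 + (-k 1) ^ 2 = 5 :=
        ⟨by rw [h.1, neg_zero], by rw [neg_sq, neg_sq]; exact h.2⟩
      fin_cases i
      · show wc (-k 0) (-k 1) (-k 2) 0 = conj (wc (k 0) (k 1) (k 2) 0)
        rw [wc_zero, wc_zero, if_pos h, if_pos h', map_mul, map_mul, conj_I, map_intCast, map_intCast]
        push_cast; ring
      · show wc (-k 0) (-k 1) (-k 2) 1 = conj (wc (k 0) (k 1) (k 2) 1)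
        rw [wc_one, wc_one, if_pos h, if_pos h', map_mul, map_mul, map_neg, conj_I, map_intCast,
          map_intCast]
        push_cast; ring
      · show wc (-k 0) (-k 1) (-k 2) 2 = conj (wc (k 0) (k 1) (k 2) 2)
        rw [wc_two, wc_two, map_zero]
    · have h' : ¬(-k 2 = 0 ∧ (-k 0) ^ 2 + (-k 1) ^ 2 = 5) := by
        rintro ⟨h1, h2⟩; exact h ⟨by simpa using h1, by rw [neg_sq, neg_sq] at h2; exact h2⟩
      rw [wc_of_not h, wc_of_not h', map_zero]
  divFree k := by
    show ∑ i, ((k i : ℤ) : ℂ) * wc (k 0) (k 1) (k 2) i = 0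
    rw [Fin.sum_univ_three, wc_zero, wc_one, wc_two]
    by_cases h : k 2 = 0 ∧ k 0 ^ 2 + k 1 ^ 2 = 5
    · rw [if_pos h, if_pos h]; ring
    · rw [if_neg h, if_neg h]; ring

/-- [folklore] -/
theorem wit_coeff (k : Fin 3 → ℤ) : wit.coeff k = wc (k 0) (k 1) (k 2) := rfl

/-- The witness is `z`-mean: it vanishes off the plane `k₂ = 0`. [folklore] -/
theorem wit_coeff_of_offplane {k : Fin 3 → ℤ} (hk : k 2 ≠ 0) : wit.coeff k = 0 := by
  funext j
  rw [wit_coeff, wc_of_not (fun h => hk h.1)]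
  rfl

/-- The witness lives on the single shell `|k|² = 5`. [folklore] -/
theorem wit_isSingleShell : IsSingleShell wit 5 := by
  intro k hk
  by_cases h : k 2 = 0 ∧ k 0 ^ 2 + k 1 ^ 2 = 5
  · unfold knormSq
    rw [Fin.sum_univ_three, h.1]
    have h2 : ((k 0 : ℤ) : ℝ) ^ 2 + ((k 1 : ℤ) : ℝ) ^ 2 = 5 := by exact_mod_cast h.2
    push_cast
    linarith
  · exact absurd (funext fun j => by rw [wit_coeff, wc_of_not h]; rfl) hk

/-- **`û(2,1,0) = 6i ≠ 0`.** [folklore] -/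
theorem wit_coeff_two_one : wit.coeff ![2, 1, 0] 0 = 6 * I := by
  rw [wit_coeff, wc_zero]
  have h : (![2, 1, 0] : Fin 3 → ℤ) 2 = 0 ∧ (![2, 1, 0] : Fin 3 → ℤ) 0 ^ 2 + (![2, 1, 0] : Fin 3 → ℤ) 1 ^ 2 = 5 := by
    simp
  rw [if_pos h]
  simp only [Matrix.cons_val_zero, Matrix.cons_val_one]
  push_cast; ring

/-- [folklore] -/
theorem wit_coeff_two_one_ne_zero : wit.coeff ![2, 1, 0] ≠ 0 := by
  intro h
  have h0 := congrFun h 0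
  rw [wit_coeff_two_one, Pi.zero_apply] at h0
  exact mul_ne_zero (by norm_num) I_ne_zero h0

/-- Every vertical translation fixes the (`z`-mean) witness. [folklore] -/
theorem translate_vertical_wit (b : ℝ) : translate (vertical b) wit = wit := by
  refine TaylorGreenHat.fourierVelocity_ext (funext fun k => funext fun j => ?_)
  rw [translate_coeff]
  by_cases hk : k 2 = 0
  · rw [phase_vertical_of_zmean b hk, one_mul]
  · rw [wit_coeff_of_offplane hk, Pi.zero_apply, mul_zero]

/-- The quarter turn fixes the witness. [folklore] -/
theorem rotZ_act_wit : rotZ.act wit = wit := by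
  refine TaylorGreenHat.fourierVelocity_ext (funext fun k => funext fun i => ?_)
  rw [LatticeIsometry.act_coeff, rotZ_invK]
  simp only [wit_coeff, Matrix.cons_val_zero, Matrix.cons_val_one, Matrix.head_cons, Matrix.cons_val_two,
    Matrix.tail_cons]
  by_cases h : k 2 = 0 ∧ k 0 ^ 2 + k 1 ^ 2 = 5
  · have h' : k 2 = 0 ∧ k 1 ^ 2 + k 0 ^ 2 = 5 := ⟨h.1, by linarith [h.2]⟩
    unfold rotZ
    fin_cases i <;> simp [Fin.sum_univ_three, wc_zero, wc_one, wc_two, if_pos h, if_pos h'] <;> ring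
  · have h' : ¬(k 2 = 0 ∧ (k 1) ^ 2 + (-k 0) ^ 2 = 5) := by
      rintro ⟨h1, h2⟩; exact h ⟨h1, by rw [neg_sq] at h2; linarith⟩
    simp [wc_of_not h, wc_of_not h']

/-- `G = T_a ∘ (x ↦ -x)` fixes the witness, for every vertical shift `a`. [folklore] -/
theorem reflX_sg_wit (a : ℝ) : reflX.sg (vertical a) wit = wit := by
  refine TaylorGreenHat.fourierVelocity_ext (funext fun k => funext fun i => ?_)
  rw [LatticeIsometry.sg_def, translate_coeff, LatticeIsometry.act_coeff, reflX_invK]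
  simp only [wit_coeff, Matrix.cons_val_zero, Matrix.cons_val_one, Matrix.head_cons, Matrix.cons_val_two,
    Matrix.tail_cons]
  by_cases h : k 2 = 0 ∧ k 0 ^ 2 + k 1 ^ 2 = 5
  · rw [phase_vertical_of_zmean a h.1, one_mul]
    unfold reflX
    fin_cases i <;> simp [Fin.sum_univ_three, wc_zero, wc_one, wc_two, if_pos h]
  · have h' : ¬(k 2 = 0 ∧ (-k 0) ^ 2 + (k 1) ^ 2 = 5) := by
      rintro ⟨h1, h2⟩; exact h ⟨h1, by rw [neg_sq] at h2; exact h2⟩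
    simp [wc_of_not h, wc_of_not h']

/-- `S = T_a ∘ (z ↦ -z)` fixes the witness, for every vertical shift `a`. [folklore] -/
theorem reflZ_sg_wit (a : ℝ) : reflZ.sg (vertical a) wit = wit := by
  refine TaylorGreenHat.fourierVelocity_ext (funext fun k => funext fun i => ?_)
  rw [LatticeIsometry.sg_def, translate_coeff, LatticeIsometry.act_coeff, reflZ_invK]
  simp only [wit_coeff, Matrix.cons_val_zero, Matrix.cons_val_one, Matrix.head_cons, Matrix.cons_val_two,
    Matrix.tail_cons]
  by_cases h : k 2 = 0 ∧ k 0 ^ 2 + k 1 ^ 2 = 5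
  · rw [phase_vertical_of_zmean a h.1, one_mul]
    unfold reflZ
    fin_cases i <;> simp [Fin.sum_univ_three, wc_zero, wc_one, wc_two, if_pos h]
  · have h' : ¬(-k 2 = 0 ∧ (k 0) ^ 2 + (k 1) ^ 2 = 5) := by
      rintro ⟨h1, h2⟩; exact h ⟨by simpa using h1, h2⟩
    simp [wc_of_not h, wc_of_not h']

/-- **SHARPNESS OF THE MIRROR-LINE THEOREM.** There is a real, divergence-free Fourier velocity on the single
shell `|k|² = 5`, fixed by `G = T_a∘(x ↦ -x)` and `S = T_a∘(z ↦ -z)` for every vertical shift `a`, by the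
quarter turn and by every vertical translation, whose coefficient at `(2,1,0)` is nonzero: the hypotheses of
`coeff_eq_zero_of_mirror_line` (and, at the initial time, of `mirror_lines_empty` / `low_modes_empty`) force
nothing beyond the mirror lines / `|k|² ≤ 4` in the `z`-mean plane (GADGETS F46-1's `A₂` witness).
[folklore] -/
theorem mirror_line_sharp : ∃ W : FourierVelocity, IsSingleShell W 5 ∧
    (∀ a : ℝ, reflX.sg (vertical a) W = W) ∧ (∀ a : ℝ, reflZ.sg (vertical a) W = W) ∧ rotZ.act W = W ∧
    (∀ b : ℝ, translate (vertical b) W = W) ∧ W.coeff ![2, 1, 0] ≠ 0 :=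
  ⟨wit, wit_isSingleShell, reflX_sg_wit, reflZ_sg_wit, rotZ_act_wit, translate_vertical_wit,
    wit_coeff_two_one_ne_zero⟩

end Summit.NavierStokesRegularity.FluidComputer.DihedralSector

end
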